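/-
Origin: expansion seat `planner-pub-hodgecm-mc-axioms-1-g14-0`, handover #W16 2026-08-20T15:53:55Z md5 f640f56494ff (PKG a258e7c29723 → f640f56494ff; 417 l.; MECHANICAL (iib-R) rewrite v3.1 of the PKG file as it stands (115 token edits; rules R1x1+R2x15+RX[h₂']x72+R3x5+R8x22)) (`HOME/mc/pub-hodgecm-mc-axioms-1-g14/revendor/kit-r55/stage55/HodgeCM/Model/EmbInstance.lean`, md5 f640f56494ff, 417 lines);
landed by the gen-22 packager (p-g22) in gate run 55 REPLACES the earlier landed copy of `HodgeCM/Model/EmbInstance.lean` (seat copy carried the packager Origin header of an earlier run (stripped)).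
-/
/-
Origin: CONSTRUCTION seat `planner-pub-hodgecm-mc-glue-1-g6-0` (unit pub-hodgecm-mc-glue-1-g6, gen 6 of mc-glue-1, node E ASSEMBLER + (W1) root packet), 2026-08-19T15:50Z — revision (W1) of `HodgeCM/Model/EmbInstance.lean` for the RUN-37 `Level`-pair ROOT PACKET (kit `mc/pub-hodgecm-mc-glue-1-g6/t37-mcglue1g6.txt`); base ‴ ce5cf2bca8bd (glue-1-g5 RUN-36 row #340, 410 l.). REPLACE (revision ⁗) — re-cut on the (W1) root: the E-side lift/pairing at the level's OWN compact open `K := Γ.K` (`UnitaryGroup.levelOf (Level.isCongruenceSubgroup_coe Γ)` ↦ `Γ.K`, `arithmeticLevel_levelOf` ↦ `Γ.arithmeticLevel_K`, `isOpen_levelOf` ↦ `Γ.isOpen_K`); every declaration name and statement unchanged. Kernel only: 0 `proof-hole`, 0 records, 0 `def … : Prop`, cites nothing new; expected `#print axioms` ⊆ {propext, Classical.choice, Quot.sound}.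
-/
/-
Origin: CONSTRUCTION seat `planner-pub-hodgecm-mc-glue-1-g5-0` (unit pub-hodgecm-mc-glue-1-g5, gen 5 of mc-glue-1, nodes E ASSEMBLER + J-Syl), 2026-08-19T13:05Z — revision ‴ (J-x₀-emb) of `HodgeCM/Model/EmbInstance.lean` per ruling (J-x₀) model1-g6 11:03:25Z («EVERY ι₁ pin refers to this one point»): E's `emb` at the UNIFORM Sylvester frame: + `import HodgeCM.Model.Junction.SylvesterFrame`, + `Model.embFrame`/`embFrame_T` (Junction §1) and `embFrameOf`/`embFrameOf_T` (Regime), the per-level arbitrary frame `(embDatum …).nonempty_sylvesterFrame.some` ↦ `embFrameOf Γ h` (matrix `V.sylvesterFrame`) at its 4 sites (`embAdelicLift` body; statements of `embAdelicLift_eq`, `inner_embLift_eq_integral`); every other byte = RUN-33 PKG 75c4bb6f6a0a; names and TYPES of `embTopForm`/`embAdelicLift`/`embLift`/`embOf`/`embOf_apply`/`embLift_apply`/`inner_embLift` unchanged. KERNEL only: 0 records, 0 `def … : Prop`, 0 proof holes; MODEL-N ±0; E binders ±0 (E files 0 textual change).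
-/
/-
Origin: expansion seat `planner-pub-hodgecm-mc-glue-1-g3-0`, handover #264 2026-08-19T00:16Z md5 873e77db032b22665c4bf40805e40127 (REPLACES my 23:55Z bytes 0139d7853631 — v2 = the SAME file re-based on the STANDARD Hodge model: `embHodgeModel Γ := stdModel hHD (isSmoothProjective_pms …)` (tree (A) `HodgeTheory/StandardHodgeModel.lean` p181344 ACCEPTED, twin = row #284 — v2 IMPORTS #284, install #284 with/before this row), now an `abbrev` so `(embHodgeModel Γ).model` (`HOME/mc/pub-hodgecm-mc-glue-1-g3/lean/EmbInstance.lean`, md5 873e77db, 375 lines);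
landed by the gen-9 packager (p-g9) in gate run 33 as `HodgeCM/Model/EmbInstance.lean` (verbatim).
-/
/-
Origin: CONSTRUCTION seat `planner-pub-hodgecm-mc-glue-1-g3-0` (unit pub-hodgecm-mc-glue-1-g3, gen 3 of mc-glue-1,
node E ASSEMBLER), 2026-08-18.  MODEL-DAG node E rev-3c, vacancy (ii) `emb`, ruling (N′) 23:12:55Z PKG HALF (P):
the `emb` binder of `Model.perL_picardCM_r4` (`HodgeCM/Model/E2InstanceR4.lean` l.48) as a PKG TERM.
KERNEL only: 0 records, 0 `def … : Prop`, 0 proof holes; MODEL-N += 0.  Tree inputs enter only as verbatim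
vendored twins `HodgeCM.Vendored.H21.*` (packets V-cov / V-emb / V-emb2 / V-emb3).
-/
import Summits.HodgeConjecture.HodgeCM.Model.CoverInstance
import Summits.HodgeConjecture.HodgeCM.Model.Junction.SylvesterFrame
import Summits.HodgeConjecture.HodgeCM.Model.Junction.QuotientModelTransport
import Summits.HodgeConjecture.HodgeCM.Model.Junction.TreeTwins
import Literature.AlgebraicGeometry.HodgeTheory.HodgeModelTopFormOfClass
import Literature.AlgebraicGeometry.HodgeTheory.HolomorphicTopFormClassesBijective
import Literature.AlgebraicGeometry.HodgeTheory.StandardHodgeModel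
import Literature.NumberTheory.Automorphic.UnitaryGroupCongruenceSubgroupLevels
import Literature.AlgebraicGeometry.ShimuraVarieties.UnitaryBallAdelicLift

/-!
# Node E rev-3c (P): the `emb` map of the Picard–CM model universe

For the model universe `U := picardCMUniverse hHD hI h₁ hU h₃` (`HodgeCM/Model/Universe.lean`) this file
constructs, with NO new hypothesis, the linear maps

  `Model.embOf hHD hI h₁ hU h₃ Γ : U.CohC (U.pms L ι₁ V Γ) 2 →ₗ[ℂ] (V.latticeModel hP).toQuotientModel.H`

(`hP := printFact_unitaryCompact_holds`, a kernel theorem) of EXACTLY the type of the binder `emb` of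
`Model.perL_picardCM_r4`, for every CM field `L`, embedding `ι₁`, hermitian space `V` and level `Γ`.

In the anisotropic regime `h : IsAnisotropic L V.Hm` (the only regime the PerL cone evaluates, cf. the `h : Bool`
regime switch of the end-state theorem) `embOf Γ = embLift Γ h` is the composite of four KERNEL maps:

1. `embTopForm Γ : H²(X_Γ(ℂ), ℂ) →ₗ[ℂ] Ω²_hol(X_Γ^an)` — the top-holomorphic-form-of-class map of the STANDARD
   Hodge model `A := stdModel hHD hX` (tree `HodgeTheory/StandardHodgeModel`: the standard analytification charted on
   `ℂ²`, comparison `(stdFamily 2) ⊗ ℂ` — natural AND multiplicative — by `rfl`) of the smooth projective surface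
   `X_Γ := U.pms L ι₁ V Γ` (`HodgeModel.topFormOfClass`, its `(p,q)`-bijectivity hypothesis discharged by the kernel
   theorem `HodgeModel.topHolFormClassPQ_bijective`; vendored twins of `HodgeTheory/HodgeModelTopFormOfClass`,
   `HolomorphicTopFormClassesBijective`, `StandardHodgeModel`); the standard model is the one the period lane's
   `Model.ballOf` reads degree-1 classes in, and the multiplicativity of its comparison is what makes the Betti side
   of the inner-product identity C2 (`trC (η ∪ η̄′) = c · ∫ ω_η ∧ ω̄_η′`) a tree theorem for it;
2. `embAdelicLift Γ h : Ω²_hol(X_Γ^an) →ₗ[ℂ] L²(U(V)(L⁺)\U(V)(𝔸_{L⁺}), regimeν)` — the ADELIC LIFT of the tree leaf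
   (T) `UnitaryBallUniformisationDatum.adelicHolFormLift` (axioms-3-g3, `ShimuraVarieties/UnitaryBallAdelicLift`): pull a
   form back to the ball through the uniformisation datum `D := U.ballDatumOf … Γ h` of `X_Γ` (clauses
   `BallQuotientUniformised` / `SpecialCyclesAlgebraic` of the universe), lift along the archimedean projection to the
   principal piece `Λ_K \ U(V)(L ⊗ ℝ)` of `[U(V)]` at the level's compact open `K := Γ.K` (the pair `Level = (Γ, K)` of `HodgeCM.CM.Basic`), extend by zero; the piece is
   compact by Godement's criterion applied to `h` (inside (T): `compactSpace_arch_quotient_cmPrincipalLattice_of_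
   anisotropic`, autform-2-g3's (b)); the PKG discharges (T)'s hypotheses `hH`, `hK`, `hΓ₀`, `hKo`, `hanis` by the
   junction lemmas of § 1 (`datum_H` / `datum_Γ` of the realisation + `PicardCode.ofHermitian_*`, `Level.arithmeticLevel_K`);
3. `V.regimeTransportL2 hP h : L²([U(V)], regimeν) ≃ₗᵢ[ℂ] (V.latticeModel hP).toQuotientModel.H` — the PKG's
   isometric transport to the quotient model of the universe (`Junction/QuotientModelTransport`).

Off regime `embOf Γ := 0` (never evaluated by the cone).  § 0 fixes the Borel σ-algebra on `[U(H)]` once, as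
global instances under both spellings of the adelic unitary group (PKG originals `HodgeCM.Adelic.*` and their
tree twins agree by `rfl`, `Junction/TreeTwins`), so that (T)'s instance arguments and the PKG's `regimeν` /
`regimeTransportL2` meet without transport.  § 3 records the unfolding and inner-product lemmas the C2 / D1-G
consumers use (`embLift_apply`, `inner_embLift`, `inner_embLift_eq_integral` = (T)'s `inner_adelicHolFormLift`
through the isometry).
-/

noncomputable section

set_option autoImplicit false

open scoped Matrix ComplexOrder TensorProduct InnerProductSpace
open NumberField MeasureTheory
open Literature.AlgebraicGeometry.Motives
open Literature.AlgebraicGeometry.ShimuraVarieties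
open Literature.AlgebraicGeometry.HodgeTheory
open Literature.Geometry.Kaehler (holFormsInCharts)
open Literature.NumberTheory.Automorphic
open Literature.NumberTheory.Automorphic.PicardCM

namespace HodgeCM

namespace Model

/-! ### 0. The Borel σ-algebra on `[U(H)] = U(H)(𝔸_{L⁺}) ⧸ U(H)(L⁺)` (both spellings) -/

section BorelCurrency

variable (K : Type) [Field K] [NumberField K] [IsCMField K] (H : Matrix (Fin 3) (Fin 3) K)

/-- The Borel σ-algebra on `U(H)(L⁺)\U(H)(𝔸_{L⁺})`, PKG spelling (`HodgeCM.Adelic.*`). -/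
instance measurableSpace_adelicQuot :
    MeasurableSpace (↥(HodgeCM.Adelic.adelicUnitaryGroup K H) ⧸ HodgeCM.Adelic.adelicUnitaryRat K H) :=
  borel _

/-- (Ported verbatim from the HodgeCMPerL package; no docstring in the source.) -/
instance borelSpace_adelicQuot :
    BorelSpace (↥(HodgeCM.Adelic.adelicUnitaryGroup K H) ⧸ HodgeCM.Adelic.adelicUnitaryRat K H) :=
  ⟨rfl⟩

/-- The SAME σ-algebra under the tree-twin spelling (`Literature.NumberTheory.Automorphic.adelicUnitaryGroup/Rat`,
equal to the PKG originals by `rfl`: `Junction/TreeTwins` (d)/(e)). -/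
instance measurableSpace_adelicQuot' :
    MeasurableSpace (↥(adelicUnitaryGroup K H) ⧸ adelicUnitaryRat K H) :=
  measurableSpace_adelicQuot K H

/-- (Ported verbatim from the HodgeCMPerL package; no docstring in the source.) -/
instance borelSpace_adelicQuot' : BorelSpace (↥(adelicUnitaryGroup K H) ⧸ adelicUnitaryRat K H) :=
  ⟨rfl⟩

/-- The Borel σ-algebra on the archimedean pieces `Λ \ U(H)(L ⊗_ℚ ℝ)` of `[U(H)]` (every lattice `Λ`), for the
piece measures of (T)'s `inner_adelicHolFormLift`. -/
instance measurableSpace_archQuot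
    (Λ : Subgroup ↥(UnitaryGroup.arch ↥(maximalRealSubfield K) K (IsCMField.complexConj K) 3 H)) :
    MeasurableSpace (↥(UnitaryGroup.arch ↥(maximalRealSubfield K) K (IsCMField.complexConj K) 3 H) ⧸ Λ) :=
  borel _

/-- (Ported verbatim from the HodgeCMPerL package; no docstring in the source.) -/
instance borelSpace_archQuot
    (Λ : Subgroup ↥(UnitaryGroup.arch ↥(maximalRealSubfield K) K (IsCMField.complexConj K) 3 H)) :
    BorelSpace (↥(UnitaryGroup.arch ↥(maximalRealSubfield K) K (IsCMField.complexConj K) 3 H) ⧸ Λ) :=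
  ⟨rfl⟩

end BorelCurrency

/-- `dim_ℝ ℂ² = 4`, as a `Fact` instance: the real-dimension side condition of the surface-degree statements over the
standard model space `Fin 2 → ℂ` (`cintegral` of top forms, `BallWedgeFormula`, `PeterssonWedgeFormula`, the Betti
trace/integral identity). -/
instance fact_finrank_real_fin2Complex : Fact (Module.finrank ℝ (Fin 2 → ℂ) = 4) :=
  ⟨by simp [Module.finrank_pi_fintype, Complex.finrank_real_complex]⟩


/-- `regimeν` is finite, in the tree-twin spelling of its carrier (PKG instance `isFiniteMeasure_regimeν`). -/
instance isFiniteMeasure_regimeν' (hP : PrintFact_unitaryCompact) {L : CMField} {ι₁ : L →+* ℂ}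
    (V : HermSpace3 L ι₁) (h : IsAnisotropic L V.Hm) :
    IsFiniteMeasure (α := ↥(adelicUnitaryGroup L V.Hm) ⧸ adelicUnitaryRat L V.Hm) (V.regimeν hP h) :=
  HermSpace3.isFiniteMeasure_regimeν hP V h

/-! ### 1. PKG-side junction lemmas at one level (currency of `PMSRealisation.datum_H` / `datum_Γ`) -/

section Junction

variable (hU : BallQuotientUniformisedDatum) (h₃ : CMAbelianVarietyRealised)
variable {L : CMField} {ι₁ : L →+* ℂ} {V : HermSpace3 L ι₁}

/-- `hH`: the complex Gram matrix of the ball datum of `(L, ι₁, V, Γ)` is `h^{ι₁}` (clause `datum_H` and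
`PicardCode.ofHermitian_H_map`). [folklore] -/
theorem map_Hm_eq_ballDatum_H_map (Γ : Level V) (hc : (pmsCode L ι₁ V Γ).IsAnisotropic) :
    V.Hm.map ι₁ = (Var.ballDatum hU h₃ (pmsCode L ι₁ V Γ) hc).H.map
      (Var.ballDatum hU h₃ (pmsCode L ι₁ V Γ) hc).E.subtype := by
  change _ = ((pmsRealisation hU _).datum hc).H.map ((pmsRealisation hU _).datum hc).E.subtype
  rw [(pmsRealisation hU (pmsCode L ι₁ V Γ)).datum_H hc]
  exact (PicardCode.ofHermitian_H_map ι₁ V.Hm Γ.Γ V.isHermitian V.signature_ι₁ V.posDef_of_ne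
    Γ.isCongruence Γ.torsionFree).symm

/-- LEVEL MATCH: `ι₁(Γ) = τ₁(D.Γ)` in `GL₃(ℂ)` for the ball datum `D` of `(L, ι₁, V, Γ)` (clause
`datum_Γ` and `PicardCode.ofHermitian_Γ_map`). Together with
the level's own `Level.arithmeticLevel_K : arithmeticLevel … Γ.K = Γ.Γ` this is the pair of level-match
EQUALITIES a Petersson-side junction over the (T) section variables may assume. [folklore] -/
theorem map_Γ_eq_ballDatum (Γ : Level V) (hc : (pmsCode L ι₁ V Γ).IsAnisotropic) :
    Γ.Γ.map (Matrix.GeneralLinearGroup.map ι₁) =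
      (Var.ballDatum hU h₃ (pmsCode L ι₁ V Γ) hc).Γ.map
        (Matrix.GeneralLinearGroup.map (Var.ballDatum hU h₃ (pmsCode L ι₁ V Γ) hc).E.subtype) := by
  change _ = ((pmsRealisation hU _).datum hc).Γ.map
    (Matrix.GeneralLinearGroup.map ((pmsRealisation hU _).datum hc).E.subtype)
  rw [(pmsRealisation hU (pmsCode L ι₁ V Γ)).datum_Γ hc]
  exact (PicardCode.ofHermitian_Γ_map ι₁ V.Hm Γ.Γ V.isHermitian V.signature_ι₁ V.posDef_of_ne
    Γ.isCongruence Γ.torsionFree).symm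

/-- `hΓ₀`: `ι₁(Γ) ≤ τ₁(D.Γ)` in `GL₃(ℂ)` — the inequality form of `map_Γ_eq_ballDatum` that (T)'s
`adelicHolFormLift` takes. [folklore] -/
theorem map_Γ_le_ballDatum (Γ : Level V) (hc : (pmsCode L ι₁ V Γ).IsAnisotropic) :
    Γ.Γ.map (Matrix.GeneralLinearGroup.map ι₁) ≤
      (Var.ballDatum hU h₃ (pmsCode L ι₁ V Γ) hc).Γ.map
        (Matrix.GeneralLinearGroup.map (Var.ballDatum hU h₃ (pmsCode L ι₁ V Γ) hc).E.subtype) :=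
  (map_Γ_eq_ballDatum hU h₃ Γ hc).le

/-- **The UNIFORM Sylvester frame of the ball datum of `X_Γ`** (ruling (J-x₀), model1-g6 2026-08-19T11:03:25Z:
«EVERY ι₁ pin refers to this one point»): the matrix `V.sylvesterFrame` of J-Syl (`Model/Junction/SylvesterFrame`)
— the SAME frame at every level `Γ` and the same matrix as the theta/ball side's `Model.ballFrame`
(`Model/BallInstance`, `ballFrame_t`), so that `emb`, the theta-space pin and the ball facts are read at ONE base
point `x₀ ∈ 𝔹²` (from RUN 36 row #339 on: the CM-torus fixed point, `HermSpace3.sylvesterFrame_conj_rationalTorus`).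
Revisions ≤ RUN 35 used the per-level arbitrary frame `(embDatum …).nonempty_sylvesterFrame.some` here.
`Tᴴ · Hℂ · T = J` from `hH` (`map_Hm_eq_ballDatum_H_map`) and `HermSpace3.sylvesterFrame_spec'`. [folklore] -/
def embFrame (Γ : Level V) (hc : (pmsCode L ι₁ V Γ).IsAnisotropic) :
    (Var.ballDatum hU h₃ (pmsCode L ι₁ V Γ) hc).SylvesterFrame :=
  ⟨V.sylvesterFrame, by
    change (V.sylvesterFrame : Matrix (Fin 3) (Fin 3) ℂ)ᴴ *
        (Var.ballDatum hU h₃ (pmsCode L ι₁ V Γ) hc).H.map (Var.ballDatum hU h₃ (pmsCode L ι₁ V Γ) hc).E.subtype *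
        (V.sylvesterFrame : Matrix (Fin 3) (Fin 3) ℂ) = Literature.Geometry.ComplexHyperbolic.BallModel.J
    rw [← map_Hm_eq_ballDatum_H_map hU h₃ Γ hc, ← UnitaryBallUniformisationDatum.signatureMatrix_two]
    exact V.sylvesterFrame_spec'⟩

/-- (Ported verbatim from the HodgeCMPerL package; no docstring in the source.) -/
@[simp] theorem embFrame_T (Γ : Level V) (hc : (pmsCode L ι₁ V Γ).IsAnisotropic) :
    (embFrame hU h₃ Γ hc).T = V.sylvesterFrame := rfl

/-- The level's congruence property with the CM conjugation spelled as the coercion of `IsCMField.complexConj L`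
(the currency of the vendored `UnitaryGroup` files; = `HodgeCM.Level.isCongruence_coe`, name kept for the audit list). [folklore] -/
theorem Level.isCongruenceSubgroup_coe (Γ : Level V) :
    IsCongruenceSubgroup ((IsCMField.complexConj L : L ≃ₐ[↥(maximalRealSubfield L)] L) : L →+* L) V.Hm Γ.Γ :=
  Γ.isCongruence

/-- PKG anisotropy in the tree's `cmConjRingHom` spelling (`Junction/TreeTwins` (a), `rfl`). [folklore] -/
theorem hanis_of_isAnisotropic (h : IsAnisotropic L V.Hm) :
    ∀ x : Fin 3 → L, hermForm (cmConjRingHom L) V.Hm x x = 0 → x = 0 :=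
  h

end Junction

/-! ### 2. The construction -/

section EndState

variable (hHD : exists_isReal_hodgeModel) (hI : hodgePQ_independent_of_hodgeModel)
  (h₁ : BallQuotientUniformised)  (h₃ : CMAbelianVarietyRealised)

section Regime

variable {L : CMField} {ι₁ : L →+* ℂ} {V : HermSpace3 L ι₁}

/-- The surface `X_Γ := U.pms L ι₁ V Γ` is smooth projective (universe clause). -/
theorem isSmoothProjective_pms (Γ : Level V) :
    IsSmoothProjective 2 (Var.scheme (ballQuotientUniformisedDatum_of h₁) h₃ (.pms (pmsCode L ι₁ V Γ))) :=
  Var.isSmoothProjective (ballQuotientUniformisedDatum_of h₁) h₃ (.pms (pmsCode L ι₁ V Γ))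

/-- The STANDARD Hodge model of `X_Γ` (`stdModel`: standard analytification on `ℂ²`, comparison
`(stdFamily 2) ⊗ ℂ`; its Hodge decomposition is transported from the universe hypothesis `hHD`). -/
abbrev embHodgeModel (Γ : Level V) :
    HodgeModel 2 (Var.scheme (ballQuotientUniformisedDatum_of h₁) h₃ (.pms (pmsCode L ι₁ V Γ))) :=
  stdModel hHD (isSmoothProjective_pms h₁ h₃ Γ)

/-- The model space of `embHodgeModel Γ` is literally `ℂ² = Fin 2 → ℂ`. -/
theorem embHodgeModel_model (Γ : Level V) : (embHodgeModel hHD h₁ h₃ Γ).model = (Fin 2 → ℂ) := rfl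

/-- The comparison of `embHodgeModel Γ` is the complexified standard family `complexifyFun (stdFamily 2)`
(hypothesis `hde` of the tree's Betti-side trace/integral identities), by `rfl`. -/
theorem embHodgeModel_deRham_apply (Γ : Level V) (k : ℕ)
    (c : Literature.NumberTheory.Transcendental.complexDeRhamCohomology (embHodgeModel hHD h₁ h₃ Γ).model
      (embHodgeModel hHD h₁ h₃ Γ).carrier k) :
    (embHodgeModel hHD h₁ h₃ Γ).deRham (embHodgeModel hHD h₁ h₃ Γ).carrier k c =
      complexifyFun (stdFamily 2) k c :=
  rfl

/-- The real family underlying the comparison of `embHodgeModel Γ` is multiplicative (hypothesis `hem` of the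
tree's Betti-side trace/integral identities). -/
theorem embHodgeModel_family_isMultiplicative : (stdFamily 2).IsMultiplicative :=
  stdFamily_isMultiplicative 2

/-- Factor 1: the top-holomorphic-form-of-class map `H²(X_Γ(ℂ), ℂ) →ₗ[ℂ] Ω²_hol(X_Γ^an)` of the real Hodge
model. -/
def embTopForm (Γ : Level V) :
    (picardCMUniverse hHD hI h₁ h₃).CohC ((picardCMUniverse hHD hI h₁ h₃).pms L ι₁ V Γ) 2 →ₗ[ℂ]
      holFormsInCharts (embHodgeModel hHD h₁ h₃ Γ).model (embHodgeModel hHD h₁ h₃ Γ).carrier 2 :=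
  (embHodgeModel hHD h₁ h₃ Γ).topFormOfClass (isSmoothProjective_pms h₁ h₃ Γ)
    ((embHodgeModel hHD h₁ h₃ Γ).topHolFormClassPQ_bijective (isSmoothProjective_pms h₁ h₃ Γ))

/-- The uniformisation datum of `X_Γ` in the anisotropic regime (`= U.ballDatumOf L ι₁ V Γ h`). -/
abbrev embDatum (Γ : Level V) (h : IsAnisotropic L V.Hm) :
    UnitaryBallUniformisationDatum 2 (Var.scheme (ballQuotientUniformisedDatum_of h₁) h₃ (.pms (pmsCode L ι₁ V Γ))) :=
  Var.ballDatum (ballQuotientUniformisedDatum_of h₁) h₃ (pmsCode L ι₁ V Γ) ((isAnisotropic_pmsCode_iff L ι₁ V Γ).2 h)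

/-- (Ported verbatim from the HodgeCMPerL package; no docstring in the source.) -/
theorem embDatum_eq_ballDatumOf (Γ : Level V) (h : IsAnisotropic L V.Hm) :
    embDatum h₁ h₃ Γ h = ballDatumOf (hHD := hHD) (hI := hI) (hU := ballQuotientUniformisedDatum_of h₁) (h₃ := h₃) L ι₁ V Γ h :=
  rfl

/-- The uniform Sylvester frame of `embDatum Γ h` (= `embFrame`, matrix `V.sylvesterFrame`; ruling (J-x₀)). -/
abbrev embFrameOf (Γ : Level V) (h : IsAnisotropic L V.Hm) : (embDatum h₁ h₃ Γ h).SylvesterFrame :=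
  embFrame (ballQuotientUniformisedDatum_of h₁) h₃ Γ ((isAnisotropic_pmsCode_iff L ι₁ V Γ).2 h)

/-- (Ported verbatim from the HodgeCMPerL package; no docstring in the source.) -/
@[simp] theorem embFrameOf_T (Γ : Level V) (h : IsAnisotropic L V.Hm) :
    (embFrameOf h₁ h₃ Γ h).T = V.sylvesterFrame := rfl

/-- Factor 2: the ADELIC LIFT `Ω²_hol(X_Γ^an) →ₗ[ℂ] L²(U(V)(L⁺)\U(V)(𝔸_{L⁺}), regimeν)` — the tree leaf (T)
`UnitaryBallUniformisationDatum.adelicHolFormLift` at the datum of `X_Γ`, its UNIFORM Sylvester frame `embFrameOf Γ h`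
(matrix `V.sylvesterFrame`, ruling (J-x₀)), the realising triple
`(L, V.Hm, ι₁)`, the level's compact open `K := Γ.K` and the regime measure, with (T)'s hypotheses discharged:
`hH := map_Hm_eq_ballDatum_H_map`, `hK := Γ.arithmeticLevel_K.le` (so `Γ₀ := Γ` itself),
`hΓ₀ := map_Γ_le_ballDatum`, `hKo := Γ.isOpen_K`, `hanis := h`. -/
def embAdelicLift (Γ : Level V) (h : IsAnisotropic L V.Hm) :
    holFormsInCharts (embHodgeModel hHD h₁ h₃ Γ).model (embHodgeModel hHD h₁ h₃ Γ).carrier 2 →ₗ[ℂ]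
      Lp ℂ 2 (V.regimeν printFact_unitaryCompact_holds h) :=
  (embDatum h₁ h₃ Γ h).adelicHolFormLift (embHodgeModel hHD h₁ h₃ Γ)
    (embFrameOf h₁ h₃ Γ h) L V.Hm ι₁
    (map_Hm_eq_ballDatum_H_map (ballQuotientUniformisedDatum_of h₁) h₃ Γ ((isAnisotropic_pmsCode_iff L ι₁ V Γ).2 h))
    Γ.K
    Γ.arithmeticLevel_K.le
    (map_Γ_le_ballDatum (ballQuotientUniformisedDatum_of h₁) h₃ Γ ((isAnisotropic_pmsCode_iff L ι₁ V Γ).2 h))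
    Γ.isOpen_K (hanis_of_isAnisotropic h)
    (V.regimeν printFact_unitaryCompact_holds h)

/-- **The `emb` map in the anisotropic regime** `h : IsAnisotropic L V.Hm`:
`H²(X_Γ, ℂ) → Ω²_hol(X_Γ^an) → L²(U(V)(L⁺)\U(V)(𝔸), regimeν) ≅ (V.latticeModel hP).toQuotientModel.H`. -/
def embLift (Γ : Level V) (h : IsAnisotropic L V.Hm) :
    (picardCMUniverse hHD hI h₁ h₃).CohC ((picardCMUniverse hHD hI h₁ h₃).pms L ι₁ V Γ) 2 →ₗ[ℂ]
      (V.latticeModel printFact_unitaryCompact_holds).toQuotientModel.H :=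
  (V.regimeTransportL2 printFact_unitaryCompact_holds h).toLinearIsometry.toLinearMap ∘ₗ
    embAdelicLift hHD h₁ h₃ Γ h ∘ₗ embTopForm hHD hI h₁ h₃ Γ

end Regime

open scoped Classical in
/-- **`emb` for the model universe** — the term for the binder `emb` of `Model.perL_picardCM_r4`: the regime lift
`embLift` when `V.Hm` is anisotropic (always the case when `2 < [L:ℚ]`, `isAnisotropic_of_two_lt`; the PerL cone only
evaluates this branch), and `0` otherwise. -/
def embOf {L : CMField} {ι₁ : L →+* ℂ} {V : HermSpace3 L ι₁} (Γ : Level V) :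
    (picardCMUniverse hHD hI h₁ h₃).CohC ((picardCMUniverse hHD hI h₁ h₃).pms L ι₁ V Γ) 2 →ₗ[ℂ]
      (V.latticeModel printFact_unitaryCompact_holds).toQuotientModel.H :=
  if h : IsAnisotropic L V.Hm then embLift hHD hI h₁ h₃ Γ h else 0

/-! ### 3. Unfolding and inner products -/

section Lemmas

variable {L : CMField} {ι₁ : L →+* ℂ} {V : HermSpace3 L ι₁}

/-- (Ported verbatim from the HodgeCMPerL package; no docstring in the source.) -/
theorem embOf_of_isAnisotropic (Γ : Level V) (h : IsAnisotropic L V.Hm) :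
    embOf hHD hI h₁ h₃ Γ = embLift hHD hI h₁ h₃ Γ h := by
  classical
  exact dif_pos h

/-- (Ported verbatim from the HodgeCMPerL package; no docstring in the source.) -/
theorem embOf_of_not_isAnisotropic (Γ : Level V) (h : ¬ IsAnisotropic L V.Hm) :
    embOf hHD hI h₁ h₃ Γ = 0 := by
  classical
  exact dif_neg h

/-- (Ported verbatim from the HodgeCMPerL package; no docstring in the source.) -/
theorem embOf_apply (Γ : Level V) (h : IsAnisotropic L V.Hm)
    (η : (picardCMUniverse hHD hI h₁ h₃).CohC ((picardCMUniverse hHD hI h₁ h₃).pms L ι₁ V Γ) 2) :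
    embOf hHD hI h₁ h₃ Γ η =
      V.regimeTransportL2 printFact_unitaryCompact_holds h
        (embAdelicLift hHD h₁ h₃ Γ h (embTopForm hHD hI h₁ h₃ Γ η)) := by
  rw [embOf_of_isAnisotropic hHD hI h₁ h₃ Γ h]
  rfl

/-- (Ported verbatim from the HodgeCMPerL package; no docstring in the source.) -/
theorem embLift_apply (Γ : Level V) (h : IsAnisotropic L V.Hm)
    (η : (picardCMUniverse hHD hI h₁ h₃).CohC ((picardCMUniverse hHD hI h₁ h₃).pms L ι₁ V Γ) 2) :
    embLift hHD hI h₁ h₃ Γ h η =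
      V.regimeTransportL2 printFact_unitaryCompact_holds h
        (embAdelicLift hHD h₁ h₃ Γ h (embTopForm hHD hI h₁ h₃ Γ η)) :=
  rfl

/-- (T) unfolded at our arguments: the adelic lift of `X_Γ` is `adelicHolFormLift` of its datum (names the
discharges; `rfl`). -/
theorem embAdelicLift_eq (Γ : Level V) (h : IsAnisotropic L V.Hm) :
    embAdelicLift hHD h₁ h₃ Γ h =
      (embDatum h₁ h₃ Γ h).adelicHolFormLift (embHodgeModel hHD h₁ h₃ Γ)
        (embFrameOf h₁ h₃ Γ h) L V.Hm ι₁
        (map_Hm_eq_ballDatum_H_map (ballQuotientUniformisedDatum_of h₁) h₃ Γ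
          ((isAnisotropic_pmsCode_iff L ι₁ V Γ).2 h))
        Γ.K
        Γ.arithmeticLevel_K.le
        (map_Γ_le_ballDatum (ballQuotientUniformisedDatum_of h₁) h₃ Γ ((isAnisotropic_pmsCode_iff L ι₁ V Γ).2 h))
        Γ.isOpen_K (hanis_of_isAnisotropic h)
        (V.regimeν printFact_unitaryCompact_holds h) :=
  rfl

/-- **The `L²` transport is isometric**: inner products of `embLift`-images are the inner products of the adelic
lifts in `L²([U(V)], regimeν)`. [folklore] -/
theorem inner_embLift (Γ : Level V) (h : IsAnisotropic L V.Hm)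
    (η η' : (picardCMUniverse hHD hI h₁ h₃).CohC ((picardCMUniverse hHD hI h₁ h₃).pms L ι₁ V Γ) 2) :
    ⟪embLift hHD hI h₁ h₃ Γ h η', embLift hHD hI h₁ h₃ Γ h η⟫_ℂ =
      ⟪embAdelicLift hHD h₁ h₃ Γ h (embTopForm hHD hI h₁ h₃ Γ η'),
        embAdelicLift hHD h₁ h₃ Γ h (embTopForm hHD hI h₁ h₃ Γ η)⟫_ℂ :=
  LinearIsometryEquiv.inner_map_map (V.regimeTransportL2 printFact_unitaryCompact_holds h) _ _


-- port_pkg: scope closed for this part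
end Lemmas
end EndState
end Model
end HodgeCM
end
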